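import Summits.ResolutionOfSingularities.KangarooAtlas.MizutaniExtremalTypeAll
import Summits.ResolutionOfSingularities.KangarooAtlas.MizutaniExtremalHypersurface
import HarnessLib

/-!
# Mizutani's Thm. 2.8, second part, VERBATIM: the invariant form `f` of the extremal scheme and the hypersurface `B_{P,𝔭} = V(f)`

Cell `pub-rosobs`, Mizutani enclosure (seat mizutani-encloser-2, gen 8). AI-written; AI review is weaker than expert review;
NOT a resolution-of-singularities theorem (summit relevance C).

Mizutani (Nagoya Math. J. 52 (1973), Thm. 2.8, p. 90): «If `H = H(V, W)` is not a vector group (i.e. `e(H) ≥ 1`), then `dim H ≥ 2p − 1`.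
Moreover if `dim H = 2p − 1` and `H` is not a vector group with `V ∩ W = {0}`, then `H` is of the same type as Example 2.1.»  The TYPE
of `H = H(V, W)` is the pair `(V, W)` up to a field automorphism of `k` and a `k^q`-semilinear automorphism of `W` (p. 87); in Step (I)
of the proof (p. 91–92) `V = k·f`, `c(f)` := the `k^p`-span of the coefficients of `f`, `K = k^p(c(f))` has `[K : k^p] = p²`, and
«`c(f) = ker D = k^p(c₁) ⊕ k^p(c₁)c₂` … and `H` is of the same type as Example 2.1» (`f = Σ_{i<p} c₁^i (X_i + c₂ Z_i)` in a suitable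
`k^p`-basis `X_i, Z_i` of `W`).  Step (III) (p. 92): a scheme of dimension `2p − 1` and exponent `e > 1` does not exist.

The tree's `span_coords_eq_of_extremal_all` (`MizutaniExtremalTypeAll.lean`) normalises the coordinates `c` of the POINT `𝔭 = [c^{1/p}]`
(Mizutani's `f*`, the dual scheme `H*`).  This file transfers the normal form to the FORM `f = Σ a_i X_i^p` spanning
`V = (L_B)_1(𝔭) = U(𝔭) ∩ L_1` — Mizutani's literal statement — through the bi-duality `H** = H` (`extremal_of_card_eq`: the dual point
`𝔭* = [a^{1/p}]` is again extremal, with `(L_B)_1(𝔭*) = k·c`), and reads the result on Hironaka's objects: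

* `exists_eq_smul_of_ratPoint_le` — `[c'^{1/q}] ⊇ [c^{1/q}]` (as ideals, `⊆`) forces `c' = μ·c`;
* **`invForms_one_eq_span_of_extremal`** — all `p`: for the extremal point, `(L_B)_1(𝔭) = k·a` with `a_0 = 1`, `a` `k^p`-independent
  inside `k^p(y_1, y_2)` (`y ⊆ {a_i}` `p`-independent), and **`c(f) = span_{k^p}{a_i} = ⊕_{m<p, j≤1} k^p·c₀'^m c₁'^j = k^p(c₀') ⊕ k^p(c₀')c₁'`**
  for a `p`-basis `(c₀', c₁')` of `k^p(y_1, y_2)/k^p`;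
* **`exponent_eq_one_of_not_isVectorGroup`** — Step (III): `dim B_{P,𝔭} + 1 = 2p` and not a vector group ⇒ exponent `= 1`
  (here from `m(e) = 2p^e − 1`: `2p^e ≤ 2p`);
* `bIdeal_eq_span_addForm_of_hirForms_one_eq` — a point of exponent `1` with `dim B_{P,𝔭} = n` and `(U(𝔭) ∩ L)_1 = k·a` has
  `U_+(𝔭)S = (Σ a_i X_i^p)` and `U(𝔭) = k[Σ a_i X_i^p]` (Hironaka's triangular basis has one element);
* **`hirForms_one_eq_span_of_not_isVectorGroup`** — THM. 2.8, SECOND PART, AS PRINTED, on Hironaka's objects: a point `𝔭` of `ℙ^n_k` with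
  no linear form in `U(𝔭)` (`V ∩ W = 0`), `B_{P,𝔭}` not a vector group and `dim B_{P,𝔭} + 1 = 2p` has exponent `1`, `n + 1 = 2p`,
  `U(𝔭) ∩ L_1 = k·f` with `f = Σ_i a_i X_i^p` of the type of Example 2.1 (`span_{k^p}{a_i} = k^p(c₀') ⊕ k^p(c₀')c₁'`), `U(𝔭) = k[f]` and
  **`B_{P,𝔭} = Spec S/(f)`** — the hypersurface «`Spec(k[x_i, z_i]/(Σ c₁^i (x_i^p + c₂ z_i^p)))`» of Example 2.1 after the `k^p`-linear
  change of the variables `X_i^p` matching `(a_i)` with `(c₀'^m c₁'^j)`.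

## References

* H. Mizutani, *Hironaka's additive group schemes*, Nagoya Math. J. 52 (1973) 85–95: Example 2.1, Prop. 2.5, Thm. 2.8 (second part) and
  its proof, Steps (I)–(III) (p. 91–92), Lemma 2.9. [Mizutani1973HironakaGroupSchemes]
* H. Hironaka, *Additive groups associated with points of a projective space*, Ann. of Math. 92 (1970) 327–334, Th. 3 (`p = 2`).
  [Hironaka1970AdditiveGroups]
-/

noncomputable section

open MvPolynomial TensorProduct Literature.AlgebraicGeometry.Resolution
  Literature.AlgebraicGeometry.Resolution.HironakaScheme
open Literature.AlgebraicGeometry.Hironaka2017.EdgeAlgebra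

namespace Summit.ResolutionOfSingularities.KangarooAtlas.Mizutani

universe u

/-! ## `[c^{1/q}]` determines `c` up to a scalar -/

section Proportional

variable {k : Type u} [Field k] {p e : ℕ} [hp : Fact p.Prime] [CharP k p] {n : ℕ} {c c' : Fin (n + 1) → k}

/-- **`ratPoint c' ≤ ratPoint c` with `c ≠ 0` forces `c' = μ • c`**: the binomials `c'_j X_i^q − c'_i X_j^q ∈ [c'^{1/q}]` vanish at
`[c^{1/q}]`, i.e. `(c'_j c_i)^q = (c'_i c_j)^q`, and `x ↦ x^q` is injective in characteristic `p`.  In particular the vector `c` of a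
`k^{1/q}`-rational point is unique up to `k^×`. [cite: Oda1983HironakaGroupSchemeII, Thm. 3.1 (p. 1173: the point attached to φ)] -/
theorem exists_eq_smul_of_ratPoint_le (hc : c ≠ 0) (h : ratPoint k p e c' ≤ ratPoint k p e c) : ∃ μ : k, c' = μ • c := by
  classical
  obtain ⟨i₀, hi₀⟩ : ∃ i, c i ≠ 0 := by
    by_contra hn
    push Not at hn
    exact hc (funext hn)
  have key : ∀ j, c' j * c i₀ = c' i₀ * c j := by
    intro j
    have hmem := h (C_mul_X_pow_sub_mem_ratPoint (c := c') i₀ j)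
    unfold ratPoint at hmem
    rw [RingHom.mem_ker, map_sub] at hmem
    unfold ratPsi at hmem
    rw [map_mul, map_mul, map_pow, map_pow, eval₂Hom_C, eval₂Hom_C, eval₂Hom_X', eval₂Hom_X', RingHom.comp_apply,
      RingHom.comp_apply, iterateFrobenius_def, iterateFrobenius_def, mul_pow, mul_pow, ← map_pow, ← map_pow, sub_eq_zero,
      ← mul_assoc, ← mul_assoc, ← map_mul, ← map_mul, ← mul_pow, ← mul_pow] at hmem
    have h1 : (c' j * c i₀) ^ p ^ e = (c' i₀ * c j) ^ p ^ e :=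
      Polynomial.C_inj.mp (mul_right_cancel₀ (pow_ne_zero _ Polynomial.X_ne_zero) hmem)
    exact pow_char_pow_injective e h1
  refine ⟨c' i₀ / c i₀, funext fun j => ?_⟩
  rw [Pi.smul_apply, smul_eq_mul, div_mul_eq_mul_div, eq_div_iff hi₀]
  exact key j

end Proportional

/-! ## The invariant form of the extremal scheme (Mizutani's `c(f)`) -/

section Form

variable (k : Type u) [Field k] (p : ℕ) [hp : Fact p.Prime] [CharP k p] {n : ℕ}
  (𝔭 : Ideal (MvPolynomial (Fin (n + 1)) k))

/-- **THM. 2.8, SECOND PART, ON THE FORM (all `p`): `c(f) = k^p(c₁) ⊕ k^p(c₁)c₂`.**  Let `𝔭` be a point of `ℙ^n_k` with no linear form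
through it, `(L_B)_1 ≠ 0` and `n + 2 = 2p + dim (L_B)_1`.  Then `n + 1 = 2p` and `(L_B)_1(𝔭) = k·a` for ONE invariant additive form
`f = Σ_i a_i X_i^p`, normalised by `a_0 = 1`, whose coefficients are `k^p`-linearly independent, lie in the field `k^p(y_1, y_2)` of degree
`p²` generated by a `p`-independent pair `y ⊆ {a_i}`, and span over `k^p` the space `⊕_{m<p, j≤1} k^p·c₀'^m c₁'^j = k^p(c₀') ⊕ k^p(c₀')·c₁'`
for a `p`-basis `(c₀', c₁')` of `k^p(y_1, y_2)/k^p` — so that in the `k^p`-basis of `W` matching `(a_i)` with `(c₀'^m c₁'^j)` the form is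
`f = Σ_{m<p} c₀'^m (X_m + c₁' Z_m)`: «`H` is of the same type as Example 2.1».  (Proof: the dual point `[a^{1/p}]` is extremal by the
bi-duality `extremal_of_card_eq`; apply `span_coords_eq_of_extremal_all` to it and pull the normalised vector back by
`exists_eq_smul_of_ratPoint_le`.)
[cite: Mizutani1973HironakaGroupSchemes, Thm. 2.8 (second part) and its proof, Steps (I)–(II) (p. 91–92: c(f) = ker D = k^p(c₁) ⊕ k^p(c₁)c₂); Prop. 2.5 (H** = H)] -/
theorem invForms_one_eq_span_of_extremal (hP : IsPoint k 𝔭) (h0 : invForms k p 𝔭 0 = ⊥) (hV : invForms k p 𝔭 1 ≠ ⊥)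
    (hdim : n + 2 = 2 * p + Module.finrank k (invForms k p 𝔭 1)) :
    n + 1 = 2 * p ∧ ∃ (a : Fin (n + 1) → k) (y : Fin 2 → k) (_ : PIndep p 1 y) (ha : ∀ i, a i ∈ towerField 1 y)
      (x' : Fin 2 → frobPow k p 1) (c' : Fin 2 → towerField 1 y)
      (_ : IsRootTower (frobPow k p 1) (towerField 1 y) (p ^ 1) x' c'),
      a 0 = 1 ∧ LinearIndependent (frobPow k p 1) a ∧ invForms k p 𝔭 1 = Submodule.span k {a} ∧
      Set.range y ⊆ Set.range a ∧
      Submodule.span (frobPow k p 1) (Set.range fun i => (⟨a i, ha i⟩ : towerField 1 y)) =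
        Submodule.span (frobPow k p 1) (Set.range fun mj : Fin p × Fin 2 => c' 0 ^ (mj.1 : ℕ) * c' 1 ^ (mj.2 : ℕ)) := by
  classical
  have hn := (card_eq_of_extremal k p 𝔭 hP h0 hV hdim).1
  -- a nonzero invariant form `a₁` and the bi-duality
  obtain ⟨a₁, ha₁, ha₁0⟩ := Submodule.exists_mem_ne_zero_of_ne_bot hV
  obtain ⟨c, hcind, -, hVa, -, h0', hV'⟩ := extremal_of_card_eq k p 𝔭 hP h0 hn ha₁ ha₁0
  have hc0 : c ≠ 0 := fun h => hcind.ne_zero 0 (congr_fun h 0)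
  -- the dual point `𝔭* = [a₁^{1/p}]` is extremal
  have hP' : IsPoint k (ratPoint k p 1 a₁) := isPoint_ratPoint ha₁0
  have hV'' : invForms k p (ratPoint k p 1 a₁) 1 ≠ ⊥ := by
    rw [hV', Ne, Submodule.span_singleton_eq_bot]
    exact hc0
  have hdim'' : n + 2 = 2 * p + Module.finrank k (invForms k p (ratPoint k p 1 a₁) 1) := by
    rw [hV', finrank_span_singleton hc0]; omega
  obtain ⟨-, a, y, hy, ha, x', c', h', ha0, haind, heq', hya, hspan⟩ :=
    span_coords_eq_of_extremal_all k p (ratPoint k p 1 a₁) hP' h0' hV'' hdim''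
  -- `a = μ • a₁`
  obtain ⟨μ, hμ⟩ := exists_eq_smul_of_ratPoint_le (c := a₁) (c' := a) ha₁0 heq'.ge
  have hμ0 : μ ≠ 0 := by
    rintro rfl
    rw [zero_smul] at hμ
    have h1 := ha0
    rw [hμ, Pi.zero_apply] at h1
    exact zero_ne_one h1
  refine ⟨hn, a, y, hy, ha, x', c', h', ha0, haind, ?_, hya, hspan⟩
  rw [hVa, hμ]
  exact (Submodule.span_singleton_smul_eq (Ne.isUnit hμ0) a₁).symm

end Form

/-! ## Step (III) and Hironaka's objects -/

section Hironaka

variable (k : Type u) [Field k] (p : ℕ) [hp : Fact p.Prime] [CharP k p] {n : ℕ}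
  (𝔭 : Ideal (MvPolynomial (Fin (n + 1)) k))

/-- **STEP (III) of Mizutani's proof: a Hironaka scheme with `dim B_{P,𝔭} + 1 = 2p` which is not a vector group has exponent EXACTLY `1`**
— a scheme of dimension `2p − 1` and exponent `e > 1` does not exist.  (Mizutani argues by the Frobenius image of Lemma 2.7 and the
minimality of `2p − 1`; here it is immediate from the general bound `2·p^{exponent} ≤ dim B_{P,𝔭} + 1`, `mizutani_lowerBound_hironaka`.)
[cite: Mizutani1973HironakaGroupSchemes, Thm. 2.8, proof, Step (III) (p. 92)] -/
theorem exponent_eq_one_of_not_isVectorGroup [𝔭.IsPrime] (hP : IsPoint k 𝔭) (hnv : ¬ IsVectorGroup k 𝔭)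
    (hdim : ringKrullDim (MvPolynomial (Fin (n + 1)) k ⧸ bIdeal k 𝔭) + 1 = (2 * p : WithBot ℕ∞)) :
    exponent k p 𝔭 = 1 := by
  have hne : exponent k p 𝔭 ≠ 0 := fun h => hnv ((isVectorGroup_iff_exponent_eq_zero_holds k p 𝔭 hP).mpr h)
  rw [ringKrullDim_quotient_bIdeal_eq_hsDim_holds k p 𝔭 hP] at hdim
  have h1 : hsDim k p 𝔭 + 1 = 2 * p := by exact_mod_cast hdim
  have h2 := two_mul_pow_exponent_le k p 𝔭 hP
  have h3 : p ^ exponent k p 𝔭 ≤ p ^ 1 := by rw [pow_one]; omega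
  have h4 := (Nat.pow_le_pow_iff_right hp.out.one_lt).mp h3
  omega

/-- **A point of exponent `1` with `dim B_{P,𝔭} = n` (one generator) and `(U(𝔭) ∩ L)_1 = k·a` has `U_+(𝔭)S = (Σ_i a_i X_i^p)` and
`U(𝔭) = k[Σ_i a_i X_i^p]`** — Hironaka's triangular basis of `U(𝔭)` (`nonempty_triangularPresentation_multAlgebra`) has `r = n + 1 − dim = 1`
element, of exponent `exponent B_{P,𝔭} = 1`, whose coefficient vector lies in `(U ∩ L)_1 = k·a`.
[cite: Mizutani1973HironakaGroupSchemes, Example 2.1 (the H-scheme of the pair is Spec k[x,z]/(f)) and Def. 1.1; Hironaka1970CertainNumericalCharacters, Th. 3 (p. 171: U = k[σ_1, …, σ_r])] -/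
theorem bIdeal_eq_span_addForm_of_hirForms_one_eq [𝔭.IsPrime] (hP : IsPoint k 𝔭) (hexp : exponent k p 𝔭 = 1)
    (hdim : ringKrullDim (MvPolynomial (Fin (n + 1)) k ⧸ bIdeal k 𝔭) = (n : WithBot ℕ∞)) {a : Fin (n + 1) → k}
    (hVa : hirForms k p 𝔭 1 = Submodule.span k {a}) :
    bIdeal k 𝔭 = Ideal.span {addForm k p 1 a} ∧ multAlgebra k 𝔭 = Algebra.adjoin k {addForm k p 1 a} := by
  classical
  obtain ⟨P⟩ := nonempty_triangularPresentation_multAlgebra k p 𝔭 hP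
  -- one generator
  have hr : P.r = 1 := by
    have h := ringKrullDim_quotient_bIdeal_eq_sub_r k p 𝔭 hP P
    rw [hdim] at h
    have h1 : n = n + 1 - P.r := by exact_mod_cast h
    have h2 := P.r_le
    omega
  set j₀ : Fin P.r := ⟨0, by rw [hr]; exact Nat.one_pos⟩ with hj₀
  have hj : ∀ j : Fin P.r, j = j₀ := fun j => by
    ext
    have := j.isLt
    simp only [hj₀]
    omega
  -- its exponent is `exponent B = 1`
  have hexpo : P.expo j₀ = 1 := by
    have hsup : Finset.univ.sup P.expo = 1 := by rw [← exponent_eq_sup_expo k p 𝔭 P, hexp]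
    refine le_antisymm ((Finset.le_sup (Finset.mem_univ j₀)).trans hsup.le) ?_
    have h : Finset.univ.sup P.expo ≤ P.expo j₀ := Finset.sup_le fun i _ => by rw [hj i]
    rwa [hsup] at h
  -- its coefficient vector is a unit multiple of `a`
  have hcoef : P.coef j₀ ∈ Submodule.span k {a} := by
    have h := coef_mem_hirForms k p 𝔭 P j₀
    rwa [hexpo, hVa] at h
  rw [Submodule.mem_span_singleton] at hcoef
  obtain ⟨u, hu⟩ := hcoef
  have hu0 : u ≠ 0 := by
    rintro rfl
    have h1 := P.coef_pivot j₀
    rw [← hu, zero_smul, Pi.zero_apply] at h1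
    exact zero_ne_one h1
  have hgen : P.gen j₀ = C u * addForm k p 1 a := by
    rw [gen_eq_addForm, hexpo, ← hu, addForm_smul]
  have hrange : Set.range P.gen = {P.gen j₀} := by
    ext f
    simp only [Set.mem_range, Set.mem_singleton_iff]
    constructor
    · rintro ⟨j, rfl⟩
      rw [hj j]
    · rintro rfl
      exact ⟨j₀, rfl⟩
  refine ⟨?_, ?_⟩
  · rw [bIdeal_eq_span_range_gen k p 𝔭 P, hrange, hgen]
    exact Ideal.span_singleton_mul_left_unit (IsUnit.map C (Ne.isUnit hu0)) _
  · have hadj : multAlgebra k 𝔭 = Algebra.adjoin k (Set.range P.gen) := P.eq_adjoin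
    rw [hadj, hrange, hgen]
    apply le_antisymm
    · refine Algebra.adjoin_le ?_
      rw [Set.singleton_subset_iff]
      exact Subalgebra.mul_mem _ (Subalgebra.algebraMap_mem _ u) (Algebra.subset_adjoin (Set.mem_singleton _))
    · refine Algebra.adjoin_le ?_
      rw [Set.singleton_subset_iff]
      have hmem : C u * addForm k p 1 a ∈ Algebra.adjoin k {C u * addForm k p 1 a} := Algebra.subset_adjoin (Set.mem_singleton _)
      have h := Subalgebra.mul_mem _ (Subalgebra.algebraMap_mem _ u⁻¹) hmem
      rwa [MvPolynomial.algebraMap_eq, ← mul_assoc, ← map_mul, inv_mul_cancel₀ hu0, map_one, one_mul] at h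

/-- **MIZUTANI'S THM. 2.8, SECOND PART, AS PRINTED, ON HIRONAKA'S OBJECTS (all `p`, every field `k` of characteristic `p`).**  Let `𝔭` be a
point of `ℙ^n_k` such that no linear form lies in `U(𝔭)` («`V ∩ W = {0}`»), `B_{P,𝔭} = Spec S/U_+(𝔭)S` is NOT a vector group, and
`dim B_{P,𝔭} + 1 = 2p` (the minimum `m(1) = 2p − 1` of the first part).  Then: the exponent of `B_{P,𝔭}` is `1` (Step (III)); `n + 1 = 2p`;
`U(𝔭) ∩ L_1 = k·f` for ONE additive form `f = Σ_i a_i X_i^p` with `a_0 = 1`, `k^p`-independent coefficients `a_i ∈ k^p(y_1, y_2)` (`y ⊆ {a_i}` a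
`p`-independent pair, `[k^p(y_1,y_2) : k^p] = p²`) and `span_{k^p}{a_i} = ⊕_{m<p, j≤1} k^p·c₀'^m c₁'^j = k^p(c₀') ⊕ k^p(c₀')·c₁'` for a `p`-basis
`(c₀', c₁')` of `k^p(y_1, y_2)` — i.e. `f = Σ_{m<p} c₀'^m (X'_m + c₁' Z'_m)` in a `k^p`-basis `X'_m, Z'_m` of `W`, THE TYPE OF EXAMPLE 2.1 —;
`U(𝔭) = k[f]`; and **`U_+(𝔭)S = (f)`, `B_{P,𝔭} = Spec S/(f)`**: Example 2.1's hypersurface «`Spec(k[x_i, z_i]/(Σ_i c₁^i (x_i^p + c₂ z_i^p)))`».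
[cite: Mizutani1973HironakaGroupSchemes, Thm. 2.8 (second part), proof Steps (I)–(III) (p. 91–92), Lemma 2.9 (2), Example 2.1; Hironaka1970AdditiveGroups, Th. 3 (p = 2)] -/
theorem hirForms_one_eq_span_of_not_isVectorGroup [𝔭.IsPrime] (hP : IsPoint k 𝔭) (hlin : hirForms k p 𝔭 0 = ⊥)
    (hnv : ¬ IsVectorGroup k 𝔭)
    (hdim : ringKrullDim (MvPolynomial (Fin (n + 1)) k ⧸ bIdeal k 𝔭) + 1 = (2 * p : WithBot ℕ∞)) :
    exponent k p 𝔭 = 1 ∧ n + 1 = 2 * p ∧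
      ∃ (a : Fin (n + 1) → k) (y : Fin 2 → k) (_ : PIndep p 1 y) (ha : ∀ i, a i ∈ towerField 1 y)
        (x' : Fin 2 → frobPow k p 1) (c' : Fin 2 → towerField 1 y)
        (_ : IsRootTower (frobPow k p 1) (towerField 1 y) (p ^ 1) x' c'),
        a 0 = 1 ∧ LinearIndependent (frobPow k p 1) a ∧ hirForms k p 𝔭 1 = Submodule.span k {a} ∧
        multAlgebra k 𝔭 = Algebra.adjoin k {addForm k p 1 a} ∧ bIdeal k 𝔭 = Ideal.span {addForm k p 1 a} ∧
        Set.range y ⊆ Set.range a ∧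
        Submodule.span (frobPow k p 1) (Set.range fun i => (⟨a i, ha i⟩ : towerField 1 y)) =
          Submodule.span (frobPow k p 1) (Set.range fun mj : Fin p × Fin 2 => c' 0 ^ (mj.1 : ℕ) * c' 1 ^ (mj.2 : ℕ)) := by
  have hexp := exponent_eq_one_of_not_isVectorGroup k p 𝔭 hP hnv hdim
  have h0 : invForms k p 𝔭 0 = ⊥ := by rw [← hirForms_eq_invForms 𝔭 0]; exact hlin
  have hV := invForms_one_ne_bot_of_exponent_eq_one k p 𝔭 hexp h0
  have hE1 : ExponentLE k p 𝔭 1 := ((exponent_eq_iff k p 𝔭).mp hexp).1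
  have hdim₀ := hdim
  rw [ringKrullDim_quotient_bIdeal_eq_hsDim_holds k p 𝔭 hP, ← hsDimAt_eq_hsDim k p 𝔭 hE1] at hdim
  have h1 : hsDimAt k p 𝔭 1 + 1 = 2 * p := by exact_mod_cast hdim
  unfold hsDimAt at h1
  have hfin := finrank_invForms_le k p 𝔭 1
  have hdim' : n + 2 = 2 * p + Module.finrank k (invForms k p 𝔭 1) := by omega
  obtain ⟨hn, a, y, hy, ha, x', c', h', ha0, haind, hVa, hya, hspan⟩ := invForms_one_eq_span_of_extremal k p 𝔭 hP h0 hV hdim'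
  have hVa' : hirForms k p 𝔭 1 = Submodule.span k {a} := by rw [hirForms_eq_invForms 𝔭 1]; exact hVa
  have hdimn : ringKrullDim (MvPolynomial (Fin (n + 1)) k ⧸ bIdeal k 𝔭) = (n : WithBot ℕ∞) := by
    rw [ringKrullDim_quotient_bIdeal_eq_hsDim_holds k p 𝔭 hP, ← hsDimAt_eq_hsDim k p 𝔭 hE1]
    unfold hsDimAt
    have : n + 1 - Module.finrank k (invForms k p 𝔭 1) = n := by omega
    rw [this]
  obtain ⟨hB, hU⟩ := bIdeal_eq_span_addForm_of_hirForms_one_eq k p 𝔭 hP hexp hdimn hVa'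
  exact ⟨hexp, hn, a, y, hy, ha, x', c', h', ha0, haind, hVa', hU, hB, hya, hspan⟩

end Hironaka

end Summit.ResolutionOfSingularities.KangarooAtlas.Mizutani

end
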